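import Mathlib
import HarnessLib

/-!
# `MatrixDescartes` census — rank-one `(2,4)₁`, `1|3` split: CONFINEMENT of the resolvent profile's turning points
# (the e-signed pair form `P_e` changes sign once when `d₀ + d₃ ≤ d₁ + d₂`; chamber (C) included)

HONEST FRAMING.  Object-search cell `pub-symmetroid`, seat `val-sym-mdr-p1` (generation 18); helper file `--supports` the crux item
stmt-ValiantsHypothesis-18050 (`Theses.LacunarySymmetroid.MatrixDescartes`, OPEN, on HOLD) with NO closure claim.  Companion of
`…PivotResolventRolle` / `…PivotRankOneResolventPairForm`: there, every turning point `c` of the resolvent profile `R(x)/x^e` of the rank-one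
four-letter pencil satisfies `P_e(c) ≤ 0` for the e-SIGNED PAIR FORM `P_e(x) = ∑_{k<l} (dₖ − e)(d_l − e) wₖw_l D_{kl}² x^{dₖ+d_l}`.  HERE: on the
`1|3` split `d₀ < e < d₁ ≤ d₂ ≤ d₃` (negative signs exactly on the cross pairs `(0, l)`) with `d₀ + d₃ ≤ d₁ + d₂` — true in chamber (C) of
`…PivotRankOneReductionOneThree`, where `d₀ + d₃ < e + d₂ < d₁ + d₂` — and non-negative weights, `x ↦ P_e(x)/x^{d₀+d₃}` is NONDECREASING
(`pairForm_div_mono`: every negative term gets an exponent `≤ 0`, every positive one `≥ 0`), hence `P_e > 0` propagates to the right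
(`pairForm_pos_of_le`): all turning points of the profile lie to the left of the first point where `P_e` is positive.  Elementary real
inequalities only; nothing here bears on `MatrixDescartes` in its window, on `DoorA26` / `DoorA34`, registers / credences, or `VP ≠ VNP`.

[folklore] Monotonicity of `z ↦ z^n` on `(0, ∞)`.  No definitions, no named facts.
-/

-- `Summit.ValiantsHypothesis.ValiantsHypothesis.…` repeats a component by the D-0017 layout
-- (single-conjunct summit), which the `dupNamespace` linter flags; the name is mandated.
set_option linter.dupNamespace false

namespace Summit.ValiantsHypothesis.ValiantsHypothesis.Theorems.LacunarySymmetroidMatrixDescartes.Pivot.Resolvent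

open Finset Set
open scoped BigOperators

/-! ## 4. Confinement on the `1|3` split: the e-signed pair form changes sign once when `d₀ + d₃ ≤ d₁ + d₂` -/

/-- **One sign change of the pair form.**  On the `1|3` split (`d₀ < e < d₁ ≤ d₂ ≤ d₃`, so the cross pairs `(0, l)` carry the negative
signs) with `d₀ + d₃ ≤ d₁ + d₂` (chamber (C) of `…PivotRankOneReductionOneThree` included) and non-negative weights, the function
`x ↦ P_e(x) / x^{d₀ + d₃}` is nondecreasing on `(0, ∞)`: each negative term has exponent `≤ 0`, each positive term exponent `≥ 0` after the
division. [this file] -/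
theorem pairForm_div_mono (e d₀ d₁ d₂ d₃ : ℕ) (h0e : d₀ < e) (he1 : e < d₁) (h12 : d₁ ≤ d₂) (h23 : d₂ ≤ d₃) (hC : d₀ + d₃ ≤ d₁ + d₂)
    (v₀ v₁ v₂ v₃ : Fin 2 → ℝ) (w₀ w₁ w₂ w₃ : ℝ) (hw₀ : 0 ≤ w₀) (hw₁ : 0 ≤ w₁) (hw₂ : 0 ≤ w₂) (hw₃ : 0 ≤ w₃) (x y : ℝ) (hx : 0 < x)
    (hxy : x ≤ y) :
    (((d₀ : ℝ) - e) * ((d₁ : ℝ) - e) * w₀ * w₁ * (v₀ 0 * v₁ 1 - v₀ 1 * v₁ 0) ^ 2 * x ^ (d₀ + d₁)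
      + ((d₀ : ℝ) - e) * ((d₂ : ℝ) - e) * w₀ * w₂ * (v₀ 0 * v₂ 1 - v₀ 1 * v₂ 0) ^ 2 * x ^ (d₀ + d₂)
      + ((d₀ : ℝ) - e) * ((d₃ : ℝ) - e) * w₀ * w₃ * (v₀ 0 * v₃ 1 - v₀ 1 * v₃ 0) ^ 2 * x ^ (d₀ + d₃)
      + ((d₁ : ℝ) - e) * ((d₂ : ℝ) - e) * w₁ * w₂ * (v₁ 0 * v₂ 1 - v₁ 1 * v₂ 0) ^ 2 * x ^ (d₁ + d₂)
      + ((d₁ : ℝ) - e) * ((d₃ : ℝ) - e) * w₁ * w₃ * (v₁ 0 * v₃ 1 - v₁ 1 * v₃ 0) ^ 2 * x ^ (d₁ + d₃)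
      + ((d₂ : ℝ) - e) * ((d₃ : ℝ) - e) * w₂ * w₃ * (v₂ 0 * v₃ 1 - v₂ 1 * v₃ 0) ^ 2 * x ^ (d₂ + d₃)) / x ^ (d₀ + d₃)
    ≤ (((d₀ : ℝ) - e) * ((d₁ : ℝ) - e) * w₀ * w₁ * (v₀ 0 * v₁ 1 - v₀ 1 * v₁ 0) ^ 2 * y ^ (d₀ + d₁)
      + ((d₀ : ℝ) - e) * ((d₂ : ℝ) - e) * w₀ * w₂ * (v₀ 0 * v₂ 1 - v₀ 1 * v₂ 0) ^ 2 * y ^ (d₀ + d₂)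
      + ((d₀ : ℝ) - e) * ((d₃ : ℝ) - e) * w₀ * w₃ * (v₀ 0 * v₃ 1 - v₀ 1 * v₃ 0) ^ 2 * y ^ (d₀ + d₃)
      + ((d₁ : ℝ) - e) * ((d₂ : ℝ) - e) * w₁ * w₂ * (v₁ 0 * v₂ 1 - v₁ 1 * v₂ 0) ^ 2 * y ^ (d₁ + d₂)
      + ((d₁ : ℝ) - e) * ((d₃ : ℝ) - e) * w₁ * w₃ * (v₁ 0 * v₃ 1 - v₁ 1 * v₃ 0) ^ 2 * y ^ (d₁ + d₃)
      + ((d₂ : ℝ) - e) * ((d₃ : ℝ) - e) * w₂ * w₃ * (v₂ 0 * v₃ 1 - v₂ 1 * v₃ 0) ^ 2 * y ^ (d₂ + d₃)) / y ^ (d₀ + d₃) := by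
  have hy : 0 < y := lt_of_lt_of_le hx hxy
  have hxn : ∀ n : ℕ, 0 < x ^ n := fun n => pow_pos hx n
  have hyn : ∀ n : ℕ, 0 < y ^ n := fun n => pow_pos hy n
  -- the six quotients `z^{a+b} / z^{d₀+d₃}`
  have qdec : ∀ a : ℕ, a ≤ d₃ → y ^ (d₀ + a) / y ^ (d₀ + d₃) ≤ x ^ (d₀ + a) / x ^ (d₀ + d₃) := by
    intro a ha
    have key : ∀ z : ℝ, 0 < z → z ^ (d₀ + a) / z ^ (d₀ + d₃) = (z ^ (d₃ - a))⁻¹ := by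
      intro z hz
      have hz' : z ^ (d₀ + d₃) = z ^ (d₀ + a) * z ^ (d₃ - a) := by rw [← pow_add]; congr 1; omega
      rw [hz', div_mul_eq_div_div, div_self (pow_pos hz _).ne', one_div]
    rw [key y hy, key x hx]
    exact inv_anti₀ (pow_pos hx _) (pow_le_pow_left₀ hx.le hxy _)
  have qinc : ∀ a b : ℕ, d₀ + d₃ ≤ a + b → x ^ (a + b) / x ^ (d₀ + d₃) ≤ y ^ (a + b) / y ^ (d₀ + d₃) := by
    intro a b hab
    have key : ∀ z : ℝ, 0 < z → z ^ (a + b) / z ^ (d₀ + d₃) = z ^ (a + b - (d₀ + d₃)) := by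
      intro z hz
      have hz' : z ^ (a + b) = z ^ (d₀ + d₃) * z ^ (a + b - (d₀ + d₃)) := by rw [← pow_add]; congr 1; omega
      rw [hz', mul_div_cancel_left₀ _ (pow_pos hz _).ne']
    rw [key x hx, key y hy]
    exact pow_le_pow_left₀ hx.le hxy _
  -- signs of the six coefficients
  have c01 : ((d₀ : ℝ) - e) * ((d₁ : ℝ) - e) * w₀ * w₁ * (v₀ 0 * v₁ 1 - v₀ 1 * v₁ 0) ^ 2 ≤ 0 := by
    have h1 : ((d₀ : ℝ) - e) * ((d₁ : ℝ) - e) ≤ 0 :=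
      mul_nonpos_of_nonpos_of_nonneg (by exact_mod_cast (by omega : (d₀ : ℤ) - e ≤ 0)) (by exact_mod_cast (by omega : (0 : ℤ) ≤ (d₁ : ℤ) - e))
    have : ((d₀ : ℝ) - e) * ((d₁ : ℝ) - e) * w₀ * w₁ * (v₀ 0 * v₁ 1 - v₀ 1 * v₁ 0) ^ 2
        = (((d₀ : ℝ) - e) * ((d₁ : ℝ) - e)) * (w₀ * w₁ * (v₀ 0 * v₁ 1 - v₀ 1 * v₁ 0) ^ 2) := by ring
    rw [this]; exact mul_nonpos_of_nonpos_of_nonneg h1 (by positivity)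
  have c02 : ((d₀ : ℝ) - e) * ((d₂ : ℝ) - e) * w₀ * w₂ * (v₀ 0 * v₂ 1 - v₀ 1 * v₂ 0) ^ 2 ≤ 0 := by
    have h1 : ((d₀ : ℝ) - e) * ((d₂ : ℝ) - e) ≤ 0 :=
      mul_nonpos_of_nonpos_of_nonneg (by exact_mod_cast (by omega : (d₀ : ℤ) - e ≤ 0)) (by exact_mod_cast (by omega : (0 : ℤ) ≤ (d₂ : ℤ) - e))
    have : ((d₀ : ℝ) - e) * ((d₂ : ℝ) - e) * w₀ * w₂ * (v₀ 0 * v₂ 1 - v₀ 1 * v₂ 0) ^ 2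
        = (((d₀ : ℝ) - e) * ((d₂ : ℝ) - e)) * (w₀ * w₂ * (v₀ 0 * v₂ 1 - v₀ 1 * v₂ 0) ^ 2) := by ring
    rw [this]; exact mul_nonpos_of_nonpos_of_nonneg h1 (by positivity)
  have c03 : ((d₀ : ℝ) - e) * ((d₃ : ℝ) - e) * w₀ * w₃ * (v₀ 0 * v₃ 1 - v₀ 1 * v₃ 0) ^ 2 ≤ 0 := by
    have h1 : ((d₀ : ℝ) - e) * ((d₃ : ℝ) - e) ≤ 0 :=
      mul_nonpos_of_nonpos_of_nonneg (by exact_mod_cast (by omega : (d₀ : ℤ) - e ≤ 0)) (by exact_mod_cast (by omega : (0 : ℤ) ≤ (d₃ : ℤ) - e))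
    have : ((d₀ : ℝ) - e) * ((d₃ : ℝ) - e) * w₀ * w₃ * (v₀ 0 * v₃ 1 - v₀ 1 * v₃ 0) ^ 2
        = (((d₀ : ℝ) - e) * ((d₃ : ℝ) - e)) * (w₀ * w₃ * (v₀ 0 * v₃ 1 - v₀ 1 * v₃ 0) ^ 2) := by ring
    rw [this]; exact mul_nonpos_of_nonpos_of_nonneg h1 (by positivity)
  have c12 : 0 ≤ ((d₁ : ℝ) - e) * ((d₂ : ℝ) - e) * w₁ * w₂ * (v₁ 0 * v₂ 1 - v₁ 1 * v₂ 0) ^ 2 := by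
    have h1 : 0 ≤ ((d₁ : ℝ) - e) := by exact_mod_cast (by omega : (0 : ℤ) ≤ (d₁ : ℤ) - e)
    have h2 : 0 ≤ ((d₂ : ℝ) - e) := by exact_mod_cast (by omega : (0 : ℤ) ≤ (d₂ : ℤ) - e)
    positivity
  have c13 : 0 ≤ ((d₁ : ℝ) - e) * ((d₃ : ℝ) - e) * w₁ * w₃ * (v₁ 0 * v₃ 1 - v₁ 1 * v₃ 0) ^ 2 := by
    have h1 : 0 ≤ ((d₁ : ℝ) - e) := by exact_mod_cast (by omega : (0 : ℤ) ≤ (d₁ : ℤ) - e)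
    have h2 : 0 ≤ ((d₃ : ℝ) - e) := by exact_mod_cast (by omega : (0 : ℤ) ≤ (d₃ : ℤ) - e)
    positivity
  have c23 : 0 ≤ ((d₂ : ℝ) - e) * ((d₃ : ℝ) - e) * w₂ * w₃ * (v₂ 0 * v₃ 1 - v₂ 1 * v₃ 0) ^ 2 := by
    have h1 : 0 ≤ ((d₂ : ℝ) - e) := by exact_mod_cast (by omega : (0 : ℤ) ≤ (d₂ : ℤ) - e)
    have h2 : 0 ≤ ((d₃ : ℝ) - e) := by exact_mod_cast (by omega : (0 : ℤ) ≤ (d₃ : ℤ) - e)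
    positivity
  -- distribute the division and compare termwise
  rw [add_div, add_div, add_div, add_div, add_div, add_div, add_div, add_div, add_div, add_div]
  simp only [mul_div_assoc]
  have t01 := mul_le_mul_of_nonpos_left (qdec d₁ (h12.trans h23)) c01
  have t02 := mul_le_mul_of_nonpos_left (qdec d₂ h23) c02
  have t03 := mul_le_mul_of_nonpos_left (qdec d₃ le_rfl) c03
  have t12 := mul_le_mul_of_nonneg_left (qinc d₁ d₂ hC) c12
  have t13 := mul_le_mul_of_nonneg_left (qinc d₁ d₃ (by omega)) c13
  have t23 := mul_le_mul_of_nonneg_left (qinc d₂ d₃ (by omega)) c23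
  linarith

/-- **Confinement.**  Under the hypotheses of `pairForm_div_mono`: once the e-signed pair form is positive at some `x₀ > 0`, it stays positive on
`[x₀, ∞)`. [this file] -/
theorem pairForm_pos_of_le (e d₀ d₁ d₂ d₃ : ℕ) (h0e : d₀ < e) (he1 : e < d₁) (h12 : d₁ ≤ d₂) (h23 : d₂ ≤ d₃) (hC : d₀ + d₃ ≤ d₁ + d₂)
    (v₀ v₁ v₂ v₃ : Fin 2 → ℝ) (w₀ w₁ w₂ w₃ : ℝ) (hw₀ : 0 ≤ w₀) (hw₁ : 0 ≤ w₁) (hw₂ : 0 ≤ w₂) (hw₃ : 0 ≤ w₃) (x₀ x : ℝ) (hx₀ : 0 < x₀)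
    (hle : x₀ ≤ x)
    (hpos : 0 < ((d₀ : ℝ) - e) * ((d₁ : ℝ) - e) * w₀ * w₁ * (v₀ 0 * v₁ 1 - v₀ 1 * v₁ 0) ^ 2 * x₀ ^ (d₀ + d₁)
      + ((d₀ : ℝ) - e) * ((d₂ : ℝ) - e) * w₀ * w₂ * (v₀ 0 * v₂ 1 - v₀ 1 * v₂ 0) ^ 2 * x₀ ^ (d₀ + d₂)
      + ((d₀ : ℝ) - e) * ((d₃ : ℝ) - e) * w₀ * w₃ * (v₀ 0 * v₃ 1 - v₀ 1 * v₃ 0) ^ 2 * x₀ ^ (d₀ + d₃)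
      + ((d₁ : ℝ) - e) * ((d₂ : ℝ) - e) * w₁ * w₂ * (v₁ 0 * v₂ 1 - v₁ 1 * v₂ 0) ^ 2 * x₀ ^ (d₁ + d₂)
      + ((d₁ : ℝ) - e) * ((d₃ : ℝ) - e) * w₁ * w₃ * (v₁ 0 * v₃ 1 - v₁ 1 * v₃ 0) ^ 2 * x₀ ^ (d₁ + d₃)
      + ((d₂ : ℝ) - e) * ((d₃ : ℝ) - e) * w₂ * w₃ * (v₂ 0 * v₃ 1 - v₂ 1 * v₃ 0) ^ 2 * x₀ ^ (d₂ + d₃)) :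
    0 < ((d₀ : ℝ) - e) * ((d₁ : ℝ) - e) * w₀ * w₁ * (v₀ 0 * v₁ 1 - v₀ 1 * v₁ 0) ^ 2 * x ^ (d₀ + d₁)
      + ((d₀ : ℝ) - e) * ((d₂ : ℝ) - e) * w₀ * w₂ * (v₀ 0 * v₂ 1 - v₀ 1 * v₂ 0) ^ 2 * x ^ (d₀ + d₂)
      + ((d₀ : ℝ) - e) * ((d₃ : ℝ) - e) * w₀ * w₃ * (v₀ 0 * v₃ 1 - v₀ 1 * v₃ 0) ^ 2 * x ^ (d₀ + d₃)
      + ((d₁ : ℝ) - e) * ((d₂ : ℝ) - e) * w₁ * w₂ * (v₁ 0 * v₂ 1 - v₁ 1 * v₂ 0) ^ 2 * x ^ (d₁ + d₂)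
      + ((d₁ : ℝ) - e) * ((d₃ : ℝ) - e) * w₁ * w₃ * (v₁ 0 * v₃ 1 - v₁ 1 * v₃ 0) ^ 2 * x ^ (d₁ + d₃)
      + ((d₂ : ℝ) - e) * ((d₃ : ℝ) - e) * w₂ * w₃ * (v₂ 0 * v₃ 1 - v₂ 1 * v₃ 0) ^ 2 * x ^ (d₂ + d₃) := by
  have hx : 0 < x := lt_of_lt_of_le hx₀ hle
  have hmono := pairForm_div_mono e d₀ d₁ d₂ d₃ h0e he1 h12 h23 hC v₀ v₁ v₂ v₃ w₀ w₁ w₂ w₃ hw₀ hw₁ hw₂ hw₃ x₀ x hx₀ hle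
  have h1 : 0 < ((((d₀ : ℝ) - e) * ((d₁ : ℝ) - e) * w₀ * w₁ * (v₀ 0 * v₁ 1 - v₀ 1 * v₁ 0) ^ 2 * x₀ ^ (d₀ + d₁)
      + ((d₀ : ℝ) - e) * ((d₂ : ℝ) - e) * w₀ * w₂ * (v₀ 0 * v₂ 1 - v₀ 1 * v₂ 0) ^ 2 * x₀ ^ (d₀ + d₂)
      + ((d₀ : ℝ) - e) * ((d₃ : ℝ) - e) * w₀ * w₃ * (v₀ 0 * v₃ 1 - v₀ 1 * v₃ 0) ^ 2 * x₀ ^ (d₀ + d₃)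
      + ((d₁ : ℝ) - e) * ((d₂ : ℝ) - e) * w₁ * w₂ * (v₁ 0 * v₂ 1 - v₁ 1 * v₂ 0) ^ 2 * x₀ ^ (d₁ + d₂)
      + ((d₁ : ℝ) - e) * ((d₃ : ℝ) - e) * w₁ * w₃ * (v₁ 0 * v₃ 1 - v₁ 1 * v₃ 0) ^ 2 * x₀ ^ (d₁ + d₃)
      + ((d₂ : ℝ) - e) * ((d₃ : ℝ) - e) * w₂ * w₃ * (v₂ 0 * v₃ 1 - v₂ 1 * v₃ 0) ^ 2 * x₀ ^ (d₂ + d₃)) / x₀ ^ (d₀ + d₃)) :=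
    div_pos hpos (pow_pos hx₀ _)
  have h2 := lt_of_lt_of_le h1 hmono
  exact (div_pos_iff_of_pos_right (pow_pos hx _)).1 h2

end Summit.ValiantsHypothesis.ValiantsHypothesis.Theorems.LacunarySymmetroidMatrixDescartes.Pivot.Resolvent
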